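import Summits.BirchSwinnertonDyer.Rank1Residual.X11b.KolyvaginHloc
import Literature.NumberTheory.EllipticCurves.HeegnerPointsKolyvaginPrimaryAnnihilatorAtPrimeProofs
import Literature.NumberTheory.EllipticCurves.HeegnerPointsKolyvaginPrimaryShaBoundDivisibleProofs
import HarnessLib

/-!
# Kolyvagin's bound on `Ш(E/K)[p^∞]` (order form) AT ONE odd surjective prime `p`, REFINED by global
# divisibility: `ord_p #Ш(E/K)[p^∞] + 2t ≤ 2M₀` from the mod-`p^M` leaves (A) + (B) + (B₂) at `p`
# carrying the divisibility of the Kolyvagin classes, and the Cassels–Tate inputs at level `p^{M₀}`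
# (cell `bsd-stepL`, seat `bsd-stepL-tam3-p1` g9, crux stmt-BirchSwinnertonDyer-19109; sibling of
# x11b3-p2's `X11b/KolyvaginShaOrderAtPrime`, cell `b2b-bsdres`)

HONEST FRAMING: ONE THEOREM (no definition, no named fact, no `sorry`); CONDITIONAL on every displayed
binder; nothing booked; no mark / label / count / tier moved; BSD is not proved for any curve. This is
x11b3-p2's `KolyvaginOrder.card_sha_primary_le_at_of_leavesM₂_of_localDuality` (McCallum 1991 §1 Theorem
/ Cor. 5.6, order form, at one prime) VERBATIM with ONE extra conjunct in the leaf binder `hleaves` —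
at every level `p^M`, every Kolyvagin class `cl m` of a square-free Kolyvagin product `m` is killed by
`p^{M−t}` (for the Heegner datum: the derived point `P_m` is `p^t`-divisible in `E(K_m)`; McCallum (5)–(6),
Cor. 4.5) — and the REFINED conclusion `#Ш(E/K)[p^∞] ≤ p^{2(M₀−t)}`, `ord_p #Ш(E/K)[p^∞] + 2t ≤ 2M₀`
(`t ≤ M₀` follows): McCallum's Cor. 5.6 *"`ord_p|Ш(E/K)| = 2(M_0 − m)`"* read as the UPPER bound with `m ≥ t`,
the half Jetchev 2008 (1) / Cor. 1.5 consume = the KERNEL SHAPE, at one prime and modulo the displayed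
leaves and Cassels–Tate inputs, of the named fact
`McCallum1991_padicValNat_card_sha_primary_add_le_of_globalDivisibility` (hMcU of 19109's
`stub_factsAtThree`). Proof = the sibling's, ending in the tree's
`KolyvaginDescent.card_sha_primaryComponent_le_of_localTerm_of_pow_smul_cl_eq_zero`
(`HeegnerPointsKolyvaginPrimaryShaBoundDivisibleProofs`, this seat) with `hloc` supplied by x11b3's
`KolyvaginCT.hloc_of_localDuality`; Kolyvagin's annihilation is DERIVED from the (unrefined part of the)
leaves exactly as in the sibling.

* `KolyvaginOrder.card_sha_primary_le_at_of_leavesM₂Div_of_localDuality` — `Ш(E/K)[p^∞]` finite,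
  killed by `p^{M₀}`, `#Ш(E/K)[p^∞] ≤ p^{2(M₀−t)}`, `ord_p #Ш(E/K)[p^∞] + 2t ≤ 2M₀`.

References (locators only): [cite: McCallumLMS1991, §1 Theorem (Kolyvagin), §4 (5)–(6), Cor. 4.5,
Lemma 5.1, §5 Thm. 5.4, Cor. 5.5, Cor. 5.6] [cite: Jetchev2008, p. 812 (1), Cor. 1.5]
[cite: GrossLMS1991, §2 Thm. 2.2 (2), §10] [cite: MilneADT2006, Ch. I §6, Prop. 6.9, Thm. 6.13(a)].
-/

noncomputable section

open scoped Classical Pointwise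

namespace Summit.BirchSwinnertonDyer.Rank1Residual.X11b.KolyvaginOrder
open WeierstrassCurve NumberField IsDedekindDomain Field Function
open Literature.NumberTheory.EllipticCurves Literature.NumberTheory.EllipticCurves.KolyvaginDescent
open Literature.NumberTheory.GaloisRepresentations
open Literature.NumberTheory.GaloisCohomology
open Literature.NumberTheory.GaloisRepresentations.DiscreteGaloisModule (mu MuCarrier)
open Summit.BirchSwinnertonDyer.Rank1Residual.X11b.KolyvaginCT

-- Cup products need `LocallyCompactSpace Γ_K`; as in the tree's Cassels–Tate files.
attribute [local instance] absoluteGaloisGroup_compactSpace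

-- `CharZero` of the completions (the Cassels–Tate local terms), as in the tree's files.
attribute [local instance] charZero_placeCompletion

variable (W : WeierstrassCurve ℚ) {K : Type} [Field K] [NumberField K]

/-- **Kolyvagin's bound on `Ш(E/K)[p^∞]` at one odd prime `p` with `ρ̄_{E,p}` onto, order form,
REFINED by global divisibility, from the mod-`p^M` leaves (A) + (B) + (B₂) WITH the divisibility of the
Kolyvagin classes (`p^{M−t} · cl m = 0`) and the Cassels–Tate inputs at level `p^{M₀}`** (McCallum 1991
Cor. 5.6 read as the upper bound with `m ≥ t`; Jetchev 2008 (1)): `Ш(E/K)[p^∞]` finite,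
`p^{M₀} Ш(E/K)[p^∞] = 0`, `#Ш(E/K)[p^∞] ≤ p^{2(M₀−t)}`, `ord_p #Ш(E/K)[p^∞] + 2t ≤ 2M₀` for
`p^{M₀} x₀ = y_K ∉ p^{M₀+1} E(K)`, `1 ≤ M₀` (`t ≤ M₀` is DERIVED from the divisibility at `m = 1`: McCallum Lemma 5.1).
[cite: McCallumLMS1991, §1 Theorem (Kolyvagin), Lemma 5.1, Thm. 5.4, Cor. 5.6] [cite: Jetchev2008, p. 812 (1) and Cor. 1.5]
[cite: GrossLMS1991, §2 Thm. 2.2 (2), §10] [cite: MilneADT2006, Ch. I §6, Prop. 6.9, Thm. 6.13(a)] -/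
theorem card_sha_primary_le_at_of_leavesM₂Div_of_localDuality [W.IsElliptic]
    (hK : IsImaginaryQuadratic K) {N₀ : ℕ} [NeZero N₀] {Pt : (W.baseChange K).toAffine.Point}
    (hP : IsHeegnerPoint N₀ W K Pt) (hnt : ¬ IsOfFinAddOrder Pt) {p : ℕ} (hp : p.Prime) (hp2 : p ≠ 2)
    (hρ : W.HasSurjectiveModNGaloisRep p) (hC : Literature.NumberTheory.Automorphic.chebotarev_artinRep)
    (hW : W.exists_weilPairing p) {M₀ : ℕ} (hM₀ : 1 ≤ M₀) [NeZero (p ^ M₀)]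
    {c : K ≃ₐ[ℚ] K} (hc : c ≠ 1) (hcc : c * c = 1)
    {x₀ : (W.baseChange K).toAffine.Point} (hx₀ : p ^ M₀ • x₀ = Pt)
    (hmax : ∀ Q : (W.baseChange K).toAffine.Point, p ^ (M₀ + 1) • Q ≠ Pt)
    (t : ℕ)
    (hleaves : ∀ {M : ℕ} (_hM : 1 ≤ M)
      (hdiv : ∀ Q : geomPoints (W.baseChange K), ∃ R, ((p ^ M : ℕ) : ℤ) • R = Q)
      (c : K ≃ₐ[ℚ] K) (_hc : c ≠ 1),
      ∃ (ε : ℤ) (cl : ℕ → galH1Torsion (W.baseChange K) ((p ^ M : ℕ) : ℤ)),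
        (ε = 1 ∨ ε = -1) ∧
        IsOfFinAddOrder (Affine.Point.map (W' := W) (c : K →ₐ[ℚ] K) Pt - ε • Pt) ∧
        cl 1 = kummerMapTorsion (W.baseChange K) _ hdiv Pt ∧
        (∀ m : ℕ, Squarefree m →
          (∀ q ∈ m.primeFactors, IsKolyvaginPrime N₀ W K p q ∧ FrobEqFrobInfty W K (p ^ M) q) →
          conjAct W c _ (cl m) = (ε * (-1) ^ m.primeFactors.card) • cl m ∧
          (∀ v : HeightOneSpectrum (𝓞 K), (m : 𝓞 K) ∉ v.asIdeal →
            cl m ∈ selmerLocalKer (W.baseChange K) (v.adicCompletion K) ((p ^ M : ℕ) : ℤ)) ∧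
          (∀ ℓ : ℕ, ℓ.Prime → ℓ ∣ m → ∀ v : HeightOneSpectrum (𝓞 K), (ℓ : 𝓞 K) ∈ v.asIdeal →
            ∀ a : ℕ, (((p : ℤ) ^ a) • cl m ∈
                selmerLocalKer (W.baseChange K) (v.adicCompletion K) ((p ^ M : ℕ) : ℤ) ↔
              ((p : ℤ) ^ a) • cl (m / ℓ) ∈
                (W.baseChange K).torsionLocalKer (v.adicCompletion K) ((p ^ M : ℕ) : ℤ)))) ∧
        (∀ ℓ : ℕ, IsKolyvaginPrime N₀ W K p ℓ ∧ FrobEqFrobInfty W K (p ^ M) ℓ →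
          ∀ ν : ℤ, (ν = 1 ∨ ν = -1) → ∀ d : galH1Torsion (W.baseChange K) ((p ^ M : ℕ) : ℤ),
          conjAct W c _ d = ν • d →
          (∀ v : HeightOneSpectrum (𝓞 K), (ℓ : 𝓞 K) ∉ v.asIdeal →
            d ∈ selmerLocalKer (W.baseChange K) (v.adicCompletion K) ((p ^ M : ℕ) : ℤ)) →
          (∀ w : InfinitePlace K,
            d ∈ selmerLocalKer (W.baseChange K) w.Completion ((p ^ M : ℕ) : ℤ)) →
          ∀ s ∈ selmerGroup (W.baseChange K) ((p ^ M : ℕ) : ℤ), conjAct W c _ s = ν • s →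
          ∀ a : ℕ, a < M → ∀ v : HeightOneSpectrum (𝓞 K), (ℓ : 𝓞 K) ∈ v.asIdeal →
            ((p : ℤ) ^ a) • d ∉
              selmerLocalKer (W.baseChange K) (v.adicCompletion K) ((p ^ M : ℕ) : ℤ) →
            ((p : ℤ) ^ (M - 1 - a)) • s ∈
              (W.baseChange K).torsionLocalKer (v.adicCompletion K) ((p ^ M : ℕ) : ℤ)) ∧
        (∀ ℓ ℓ' : ℕ, IsKolyvaginPrime N₀ W K p ℓ ∧ FrobEqFrobInfty W K (p ^ M) ℓ →
          IsKolyvaginPrime N₀ W K p ℓ' ∧ FrobEqFrobInfty W K (p ^ M) ℓ' → ℓ ≠ ℓ' →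
          ∀ ν : ℤ, (ν = 1 ∨ ν = -1) → ∀ d : galH1Torsion (W.baseChange K) ((p ^ M : ℕ) : ℤ),
          conjAct W c _ d = ν • d →
          (∀ v : HeightOneSpectrum (𝓞 K), (ℓ : 𝓞 K) ∉ v.asIdeal → (ℓ' : 𝓞 K) ∉ v.asIdeal →
            d ∈ selmerLocalKer (W.baseChange K) (v.adicCompletion K) ((p ^ M : ℕ) : ℤ)) →
          (∀ w : InfinitePlace K,
            d ∈ selmerLocalKer (W.baseChange K) w.Completion ((p ^ M : ℕ) : ℤ)) →
          ∀ s ∈ selmerGroup (W.baseChange K) ((p ^ M : ℕ) : ℤ), conjAct W c _ s = ν • s →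
          (∀ v : HeightOneSpectrum (𝓞 K), (ℓ' : 𝓞 K) ∈ v.asIdeal →
            s ∈ (W.baseChange K).torsionLocalKer (v.adicCompletion K) ((p ^ M : ℕ) : ℤ)) →
          ∀ a : ℕ, a < M → ∀ v : HeightOneSpectrum (𝓞 K), (ℓ : 𝓞 K) ∈ v.asIdeal →
            ((p : ℤ) ^ a) • d ∉
              selmerLocalKer (W.baseChange K) (v.adicCompletion K) ((p ^ M : ℕ) : ℤ) →
            ((p : ℤ) ^ (M - 1 - a)) • s ∈
              (W.baseChange K).torsionLocalKer (v.adicCompletion K) ((p ^ M : ℕ) : ℤ)) ∧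
        -- GLOBAL DIVISIBILITY to depth `t` at level `p^M`: `p^{M−t} · c_M(m) = 0`
        (∀ m : ℕ, Squarefree m →
          (∀ q ∈ m.primeFactors, IsKolyvaginPrime N₀ W K p q ∧ FrobEqFrobInfty W K (p ^ M) q) →
          ((p : ℤ) ^ (M - t)) • cl m = 0))
    (e : geomTorsion (W.baseChange K) ((p ^ M₀ * p ^ M₀ : ℕ) : ℤ) →
      geomTorsion (W.baseChange K) ((p ^ M₀ * p ^ M₀ : ℕ) : ℤ) → AlgebraicClosure K)
    (hμ : ∀ S T, e S T ^ (p ^ M₀ * p ^ M₀) = 1)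
    (hadd₁ : ∀ S₁ S₂ T, e (S₁ + S₂) T = e S₁ T * e S₂ T)
    (hadd₂ : ∀ S T₁ T₂, e S (T₁ + T₂) = e S T₁ * e S T₂)
    (hgal : ∀ (σ : absoluteGaloisGroup K) (S T : geomTorsion (W.baseChange K) ((p ^ M₀ * p ^ M₀ : ℕ) : ℤ)),
      σ • e S T = e (σ • S) (σ • T))
    (halt : ∀ T, e T T = 1) (hnondeg : ∀ T, (∀ S, e S T = 1) → T = 0)
    (inv : LocalInvariants K (p ^ M₀ * p ^ M₀)) (hPT' : inv.SumInvLocalizationEqZero)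
    (hinv : ∀ v : HeightOneSpectrum (𝓞 K), Injective (inv (Sum.inr v)))
    (hH3 : ∀ x : galoisCohomology (mu K (p ^ M₀ * p ^ M₀)) 3,
      (∀ v : Place K, galoisCohomology.localization (mu K (p ^ M₀ * p ^ M₀)) v 3 x = 0) → x = 0)
    (hB : Literature.GroupTheory.FiniteAbelian.IsLevelPairing (p ^ M₀)
      (ctLevelPairing (W.baseChange K) (p ^ M₀) e hμ hadd₁ hadd₂ hgal inv halt hPT' hH3
        (localTerm_finite_support (W := W.baseChange K) (m := p ^ M₀) (e := e) (hμ := hμ)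
          (hadd₁ := hadd₁) (hadd₂ := hadd₂) (hgal := hgal) halt inv)))
    (hPτ : ∀ z ∈ selmerGroup (W.baseChange K) ((p ^ M₀ * p ^ M₀ : ℕ) : ℤ),
      ∀ t ∈ selmerGroup (W.baseChange K) ((p ^ M₀ * p ^ M₀ : ℕ) : ℤ),
      ctGeneralFun (W.baseChange K) (p ^ M₀) e hμ hadd₁ hadd₂ hgal inv
          (torsionH1ToH1 (W.baseChange K) _ (conjAct W c _ z))
          (torsionH1ToH1 (W.baseChange K) _ (conjAct W c _ t)) =
        ctGeneralFun (W.baseChange K) (p ^ M₀) e hμ hadd₁ hadd₂ hgal inv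
          (torsionH1ToH1 (W.baseChange K) _ z) (torsionH1ToH1 (W.baseChange K) _ t)) :
    Finite (AddCommGroup.primaryComponent (W.baseChange K).sha p) ∧
    (∀ c ∈ AddCommGroup.primaryComponent (W.baseChange K).sha p, p ^ M₀ • c = 0) ∧
    Nat.card (AddCommGroup.primaryComponent (W.baseChange K).sha p) ≤ p ^ (2 * (M₀ - t)) ∧
    padicValNat p (Nat.card (AddCommGroup.primaryComponent (W.baseChange K).sha p)) + 2 * t ≤
      2 * M₀ := by
  haveI : Fact p.Prime := ⟨hp⟩
  -- the unrefined leaves (drop the divisibility conjunct), for the annihilation theorems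
  have hleaves' : ∀ {M : ℕ} (_hM : 1 ≤ M)
      (hdiv : ∀ Q : geomPoints (W.baseChange K), ∃ R, ((p ^ M : ℕ) : ℤ) • R = Q)
      (c : K ≃ₐ[ℚ] K) (_hc : c ≠ 1),
      ∃ (ε : ℤ) (cl : ℕ → galH1Torsion (W.baseChange K) ((p ^ M : ℕ) : ℤ)),
        (ε = 1 ∨ ε = -1) ∧
        IsOfFinAddOrder (Affine.Point.map (W' := W) (c : K →ₐ[ℚ] K) Pt - ε • Pt) ∧
        cl 1 = kummerMapTorsion (W.baseChange K) _ hdiv Pt ∧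
        (∀ m : ℕ, Squarefree m →
          (∀ q ∈ m.primeFactors, IsKolyvaginPrime N₀ W K p q ∧ FrobEqFrobInfty W K (p ^ M) q) →
          conjAct W c _ (cl m) = (ε * (-1) ^ m.primeFactors.card) • cl m ∧
          (∀ v : HeightOneSpectrum (𝓞 K), (m : 𝓞 K) ∉ v.asIdeal →
            cl m ∈ selmerLocalKer (W.baseChange K) (v.adicCompletion K) ((p ^ M : ℕ) : ℤ)) ∧
          (∀ ℓ : ℕ, ℓ.Prime → ℓ ∣ m → ∀ v : HeightOneSpectrum (𝓞 K), (ℓ : 𝓞 K) ∈ v.asIdeal →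
            ∀ a : ℕ, (((p : ℤ) ^ a) • cl m ∈
                selmerLocalKer (W.baseChange K) (v.adicCompletion K) ((p ^ M : ℕ) : ℤ) ↔
              ((p : ℤ) ^ a) • cl (m / ℓ) ∈
                (W.baseChange K).torsionLocalKer (v.adicCompletion K) ((p ^ M : ℕ) : ℤ)))) ∧
        (∀ ℓ : ℕ, IsKolyvaginPrime N₀ W K p ℓ ∧ FrobEqFrobInfty W K (p ^ M) ℓ →
          ∀ ν : ℤ, (ν = 1 ∨ ν = -1) → ∀ d : galH1Torsion (W.baseChange K) ((p ^ M : ℕ) : ℤ),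
          conjAct W c _ d = ν • d →
          (∀ v : HeightOneSpectrum (𝓞 K), (ℓ : 𝓞 K) ∉ v.asIdeal →
            d ∈ selmerLocalKer (W.baseChange K) (v.adicCompletion K) ((p ^ M : ℕ) : ℤ)) →
          (∀ w : InfinitePlace K,
            d ∈ selmerLocalKer (W.baseChange K) w.Completion ((p ^ M : ℕ) : ℤ)) →
          ∀ s ∈ selmerGroup (W.baseChange K) ((p ^ M : ℕ) : ℤ), conjAct W c _ s = ν • s →
          ∀ a : ℕ, a < M → ∀ v : HeightOneSpectrum (𝓞 K), (ℓ : 𝓞 K) ∈ v.asIdeal →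
            ((p : ℤ) ^ a) • d ∉
              selmerLocalKer (W.baseChange K) (v.adicCompletion K) ((p ^ M : ℕ) : ℤ) →
            ((p : ℤ) ^ (M - 1 - a)) • s ∈
              (W.baseChange K).torsionLocalKer (v.adicCompletion K) ((p ^ M : ℕ) : ℤ)) ∧
        (∀ ℓ ℓ' : ℕ, IsKolyvaginPrime N₀ W K p ℓ ∧ FrobEqFrobInfty W K (p ^ M) ℓ →
          IsKolyvaginPrime N₀ W K p ℓ' ∧ FrobEqFrobInfty W K (p ^ M) ℓ' → ℓ ≠ ℓ' →
          ∀ ν : ℤ, (ν = 1 ∨ ν = -1) → ∀ d : galH1Torsion (W.baseChange K) ((p ^ M : ℕ) : ℤ),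
          conjAct W c _ d = ν • d →
          (∀ v : HeightOneSpectrum (𝓞 K), (ℓ : 𝓞 K) ∉ v.asIdeal → (ℓ' : 𝓞 K) ∉ v.asIdeal →
            d ∈ selmerLocalKer (W.baseChange K) (v.adicCompletion K) ((p ^ M : ℕ) : ℤ)) →
          (∀ w : InfinitePlace K,
            d ∈ selmerLocalKer (W.baseChange K) w.Completion ((p ^ M : ℕ) : ℤ)) →
          ∀ s ∈ selmerGroup (W.baseChange K) ((p ^ M : ℕ) : ℤ), conjAct W c _ s = ν • s →
          (∀ v : HeightOneSpectrum (𝓞 K), (ℓ' : 𝓞 K) ∈ v.asIdeal →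
            s ∈ (W.baseChange K).torsionLocalKer (v.adicCompletion K) ((p ^ M : ℕ) : ℤ)) →
          ∀ a : ℕ, a < M → ∀ v : HeightOneSpectrum (𝓞 K), (ℓ : 𝓞 K) ∈ v.asIdeal →
            ((p : ℤ) ^ a) • d ∉
              selmerLocalKer (W.baseChange K) (v.adicCompletion K) ((p ^ M : ℕ) : ℤ) →
            ((p : ℤ) ^ (M - 1 - a)) • s ∈
              (W.baseChange K).torsionLocalKer (v.adicCompletion K) ((p ^ M : ℕ) : ℤ)) := by
    intro M hM hdiv c hc
    obtain ⟨ε, cl, hε, h53, hc1, hcl, hdual, hdual₂, -⟩ := hleaves hM hdiv c hc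
    exact ⟨ε, cl, hε, h53, hc1, hcl, hdual, hdual₂⟩
  haveI : (W.baseChange K).IsElliptic := inferInstanceAs (W.map (algebraMap ℚ K)).IsElliptic
  have hn2 : p ^ M₀ * p ^ M₀ = p ^ (2 * M₀) := by rw [two_mul, pow_add]
  -- `E(K)[p] = 0`
  have hbot := torsionBy_eq_bot_of_isImaginaryQuadratic W K hK hp hp2 hρ
  have hA : ∀ a : (W.baseChange K).toAffine.Point, p • a = 0 → a = 0 := fun a ha ↦ by
    have : a ∈ AddSubgroup.torsionBy (W.baseChange K).toAffine.Point (p : ℤ) := by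
      rw [mem_torsionBy_iff, natCast_zsmul]; exact ha
    rw [hbot] at this
    exact this
  -- divisibility of the geometric points at every level
  have hdivj : ∀ n : ℕ, n ≠ 0 →
      ∀ Q : geomPoints (W.baseChange K), ∃ R, ((n : ℕ) : ℤ) • R = Q := fun n hn ↦
    (W.baseChange K).zsmul_geomPoints_surjective_holds (by exact_mod_cast hn)
  have hn0 : p ^ M₀ * p ^ M₀ ≠ 0 := mul_ne_zero (pow_ne_zero _ hp.ne_zero) (pow_ne_zero _ hp.ne_zero)
  have hdiv := hdivj (p ^ M₀ * p ^ M₀) hn0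
  -- the Kummer-generator facts at a level `n = p^j` (McCallum Lemma 5.1 / (4)–(6))
  have hgen : ∀ (n j : ℕ), n = p ^ j → j ≠ 0 →
      ∀ (hdiv : ∀ Q : geomPoints (W.baseChange K), ∃ R, ((n : ℕ) : ℤ) • R = Q),
      kummerMapTorsion (W.baseChange K) _ hdiv Pt =
          ((p : ℤ) ^ M₀) • kummerMapTorsion (W.baseChange K) _ hdiv x₀ ∧
        ((p : ℤ) ^ (j - 1)) • kummerMapTorsion (W.baseChange K) _ hdiv x₀ ≠ 0 := by
    rintro n j rfl hj hdiv
    refine ⟨?_, fun h ↦ ?_⟩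
    · rw [← hx₀, map_nsmul, ← natCast_zsmul]
      congr 1
    · have hker : ((p : ℤ) ^ (j - 1)) • x₀ ∈ (kummerMapTorsion (W.baseChange K) _ hdiv).ker := by
        rw [AddMonoidHom.mem_ker, map_zsmul, h]
      rw [kummerMapTorsion_ker, AddMonoidHom.mem_range] at hker
      obtain ⟨z, hz⟩ := hker
      refine pow_smul_ne_pow_sub_one_smul hA hx₀ hmax hj z ?_
      have hz' : ((p ^ j : ℕ) : ℤ) • z = ((p : ℤ) ^ (j - 1)) • x₀ := hz
      rw [← Nat.cast_pow, natCast_zsmul, natCast_zsmul] at hz'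
      exact hz'
  obtain ⟨hPx, hxord⟩ := hgen _ (2 * M₀) hn2 (by omega) hdiv
  -- the leaves, read at the level `p^{M₀}·p^{M₀}` (level-generic restatement, by `rfl`)
  obtain ⟨Φ, hΦ⟩ : ∃ Φ : ℕ → ℕ → Prop, ∀ M n : ℕ, (Φ M n ↔
          ∀ (hdiv : ∀ Q : geomPoints (W.baseChange K), ∃ R, ((n : ℕ) : ℤ) • R = Q)
          (c : K ≃ₐ[ℚ] K) (_hc : c ≠ 1),
          ∃ (ε : ℤ) (cl : ℕ → galH1Torsion (W.baseChange K) ((n : ℕ) : ℤ)),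
            (ε = 1 ∨ ε = -1) ∧
            IsOfFinAddOrder (Affine.Point.map (W' := W) (c : K →ₐ[ℚ] K) Pt - ε • Pt) ∧
            cl 1 = kummerMapTorsion (W.baseChange K) _ hdiv Pt ∧
            (∀ m : ℕ, Squarefree m →
              (∀ q ∈ m.primeFactors, IsKolyvaginPrime N₀ W K p q ∧ FrobEqFrobInfty W K n q) →
              conjAct W c _ (cl m) = (ε * (-1) ^ m.primeFactors.card) • cl m ∧
              (∀ v : HeightOneSpectrum (𝓞 K), (m : 𝓞 K) ∉ v.asIdeal →
                cl m ∈ selmerLocalKer (W.baseChange K) (v.adicCompletion K) ((n : ℕ) : ℤ)) ∧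
              (∀ ℓ : ℕ, ℓ.Prime → ℓ ∣ m → ∀ v : HeightOneSpectrum (𝓞 K), (ℓ : 𝓞 K) ∈ v.asIdeal →
                ∀ a : ℕ, (((p : ℤ) ^ a) • cl m ∈
                    selmerLocalKer (W.baseChange K) (v.adicCompletion K) ((n : ℕ) : ℤ) ↔
                  ((p : ℤ) ^ a) • cl (m / ℓ) ∈
                    (W.baseChange K).torsionLocalKer (v.adicCompletion K) ((n : ℕ) : ℤ)))) ∧
            (∀ ℓ : ℕ, IsKolyvaginPrime N₀ W K p ℓ ∧ FrobEqFrobInfty W K n ℓ →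
              ∀ ν : ℤ, (ν = 1 ∨ ν = -1) → ∀ d : galH1Torsion (W.baseChange K) ((n : ℕ) : ℤ),
              conjAct W c _ d = ν • d →
              (∀ v : HeightOneSpectrum (𝓞 K), (ℓ : 𝓞 K) ∉ v.asIdeal →
                d ∈ selmerLocalKer (W.baseChange K) (v.adicCompletion K) ((n : ℕ) : ℤ)) →
              (∀ w : InfinitePlace K,
                d ∈ selmerLocalKer (W.baseChange K) w.Completion ((n : ℕ) : ℤ)) →
              ∀ s ∈ selmerGroup (W.baseChange K) ((n : ℕ) : ℤ), conjAct W c _ s = ν • s →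
              ∀ a : ℕ, a < M → ∀ v : HeightOneSpectrum (𝓞 K), (ℓ : 𝓞 K) ∈ v.asIdeal →
                ((p : ℤ) ^ a) • d ∉
                  selmerLocalKer (W.baseChange K) (v.adicCompletion K) ((n : ℕ) : ℤ) →
                ((p : ℤ) ^ (M - 1 - a)) • s ∈
                  (W.baseChange K).torsionLocalKer (v.adicCompletion K) ((n : ℕ) : ℤ)) ∧
            (∀ ℓ ℓ' : ℕ, IsKolyvaginPrime N₀ W K p ℓ ∧ FrobEqFrobInfty W K n ℓ →
              IsKolyvaginPrime N₀ W K p ℓ' ∧ FrobEqFrobInfty W K n ℓ' → ℓ ≠ ℓ' →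
              ∀ ν : ℤ, (ν = 1 ∨ ν = -1) → ∀ d : galH1Torsion (W.baseChange K) ((n : ℕ) : ℤ),
              conjAct W c _ d = ν • d →
              (∀ v : HeightOneSpectrum (𝓞 K), (ℓ : 𝓞 K) ∉ v.asIdeal → (ℓ' : 𝓞 K) ∉ v.asIdeal →
                d ∈ selmerLocalKer (W.baseChange K) (v.adicCompletion K) ((n : ℕ) : ℤ)) →
              (∀ w : InfinitePlace K,
                d ∈ selmerLocalKer (W.baseChange K) w.Completion ((n : ℕ) : ℤ)) →
              ∀ s ∈ selmerGroup (W.baseChange K) ((n : ℕ) : ℤ), conjAct W c _ s = ν • s →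
              (∀ v : HeightOneSpectrum (𝓞 K), (ℓ' : 𝓞 K) ∈ v.asIdeal →
                s ∈ (W.baseChange K).torsionLocalKer (v.adicCompletion K) ((n : ℕ) : ℤ)) →
              ∀ a : ℕ, a < M → ∀ v : HeightOneSpectrum (𝓞 K), (ℓ : 𝓞 K) ∈ v.asIdeal →
                ((p : ℤ) ^ a) • d ∉
                  selmerLocalKer (W.baseChange K) (v.adicCompletion K) ((n : ℕ) : ℤ) →
                ((p : ℤ) ^ (M - 1 - a)) • s ∈
                  (W.baseChange K).torsionLocalKer (v.adicCompletion K) ((n : ℕ) : ℤ)) ∧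
            (∀ m : ℕ, Squarefree m →
              (∀ q ∈ m.primeFactors, IsKolyvaginPrime N₀ W K p q ∧ FrobEqFrobInfty W K n q) →
              ((p : ℤ) ^ (M - t)) • cl m = 0)) :=
    ⟨_, fun _ _ ↦ Iff.rfl⟩
  have hΦ1 : Φ (2 * M₀) (p ^ (2 * M₀)) :=
    (hΦ _ _).mpr fun hdiv' c' hc' ↦ hleaves (M := 2 * M₀) (by omega) hdiv' c' hc'
  have hΦ2 : Φ (2 * M₀) (p ^ M₀ * p ^ M₀) := by rw [hn2]; exact hΦ1
  obtain ⟨ε, cl, hε, h53, hc1, hcl, hdual, -, hdivt⟩ := (hΦ _ _).mp hΦ2 hdiv c hc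
  -- Kolyvagin's annihilation `p^{M₀} Ш(E/K)[p^∞] = 0` (the tree's theorem at `m = M₀`)
  have hKol := pow_smul_sha_primary_eq_zero_at_of_leavesM₂ (N := N₀) W hK hnt hp hp2 hρ (m := M₀)
    hmax hC hW hleaves'
  have hL : ∀ a ∈ (W.baseChange K).sha,
      (((p ^ M₀ * p ^ M₀ : ℕ) : ℤ)) • a = 0 → ((p ^ M₀ : ℕ) : ℤ) • a = 0 := by
    intro a ha h0
    have h1 : p ^ M₀ • (⟨a, ha⟩ : (W.baseChange K).sha) = 0 := by
      refine hKol ⟨a, ha⟩ ⟨2 * M₀, Subtype.ext ?_⟩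
      rw [AddSubgroupClass.coe_nsmul, ZeroMemClass.coe_zero, ← hn2, ← natCast_zsmul]
      exact h0
    have h2 := congrArg Subtype.val h1
    rw [AddSubgroupClass.coe_nsmul, ZeroMemClass.coe_zero] at h2
    rw [natCast_zsmul]
    exact h2
  -- Kolyvagin's annihilation `p^{M₀} Sel_{p^{2M₀}} ⊆ ℤ δx₀` (McCallum Prop. 2.2 at two places)
  have hkill : ∀ s ∈ selmerGroup (W.baseChange K) ((p ^ M₀ * p ^ M₀ : ℕ) : ℤ),
      ((p : ℤ) ^ M₀) • s ∈ AddSubgroup.zmultiples (kummerMapTorsion (W.baseChange K) _ hdiv x₀) := by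
    have key : ∀ (n : ℕ), n = p ^ (2 * M₀) →
        ∀ (hdiv : ∀ Q : geomPoints (W.baseChange K), ∃ R, ((n : ℕ) : ℤ) • R = Q),
        ∀ s ∈ selmerGroup (W.baseChange K) ((n : ℕ) : ℤ),
        ((p : ℤ) ^ M₀) • s ∈
          AddSubgroup.zmultiples (kummerMapTorsion (W.baseChange K) _ hdiv x₀) := by
      rintro n rfl hdiv s hs
      obtain ⟨hPx', hxord'⟩ := hgen _ (2 * M₀) rfl (by omega) hdiv
      obtain ⟨ε', cl', hε', h53', hc1', hcl', hdual', hdual₂'⟩ :=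
        hleaves' (M := 2 * M₀) (by omega) hdiv c hc
      obtain ⟨S, hSel, hSx, hSp, hSM₀, -, hS₂⟩ := exists_hypothesesM₂_of_leavesM (N := N₀) W hK hp
        hp2 hρ hC hW (M := 2 * M₀) (by omega) hdiv hc hcc hx₀ hPx' hxord' ε' hε' h53' cl' hc1' hcl'
        hdual' hdual₂'
      have h := S.pow_M₀_zsmul_mem_zmultiples hS₂ (s := s) (by rw [hSel]; exact hs)
      rwa [hSp, hSM₀, hSx] at h
    exact key _ hn2 hdiv
  -- the divisibility at level `p^{M₀}·p^{M₀}`, exponent `2M₀ − t`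
  have hdivt' : ∀ m : ℕ, Squarefree m →
      (∀ q ∈ m.primeFactors, IsKolyvaginPrime N₀ W K p q ∧ FrobEqFrobInfty W K (p ^ M₀ * p ^ M₀) q) →
      ((p : ℤ) ^ (2 * M₀ - t)) • cl m = 0 := hdivt
  -- `t ≤ M₀`: the divisibility at `m = 1` reads `p^{2M₀ − t} · p^{M₀} · δx₀ = 0`, and `ord δx₀ = p^{2M₀}`
  -- (McCallum Lemma 5.1: `M₀ = ord_p [E(K) : ℤ y_K] ≥ min_r M_r ≥ t`)
  have ht : t ≤ M₀ := by
    by_contra hlt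
    have h1 := hdivt' 1 squarefree_one (by simp)
    rw [hc1, hPx, smul_smul] at h1
    apply hxord
    obtain ⟨k, hk⟩ := Nat.exists_eq_add_of_le (show 2 * M₀ - t + M₀ ≤ 2 * M₀ - 1 by omega)
    have hpk : ((p : ℤ) ^ (2 * M₀ - 1)) = (p : ℤ) ^ k * ((p : ℤ) ^ (2 * M₀ - t) * (p : ℤ) ^ M₀) := by
      rw [hk]; ring
    rw [hpk, ← smul_smul, h1, zsmul_zero]
  exact card_sha_primaryComponent_le_of_localTerm_of_pow_smul_cl_eq_zero W hK hP hp hp2 hρ hC hW hM₀ hdiv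
    hc hcc hx₀ hPx hxord ε hε h53 cl hc1 hcl hdual e hμ hadd₁ hadd₂ hgal halt inv hPT' hH3 hB hPτ hkill hL
    (hloc_of_localDuality W hK hP hp hp2 hM₀ hc ε hε cl hcl e hμ hadd₁ hadd₂ hgal halt hnondeg inv hinv)
    t ht hdivt'

end Summit.BirchSwinnertonDyer.Rank1Residual.X11b.KolyvaginOrder

end
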